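import Literature.AnabelianGeometry.AbsoluteAnabelian.AbsTopIII.ReconstructionCor110iProofs
import Mathlib.Algebra.Field.Shrink
import Mathlib.Algebra.Field.ULift
import HarnessLib

/-!
# [AbsTopIII] Cor. 1.10 (i)(b) at every universe: the named fact `AbsTopIII.Cor_1_10_i M` for
# `M : CurveModel.{u}` (universe-polymorphic closure of FACT-LIST row F-0394)

Mochizuki, *Topics in Absolute Anabelian Geometry III*, §1 Cor. 1.10 (i)(b) p. 42 (manuscript
pagination, lit key `paper:url-5493eb38cbb7`): "the natural surjection `G_k^ab ↠ G^unr ⥲ Ẑ`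
determined by the Frobenius element" is reconstructed group-theoretically from `G_k` (Rmk. 1.9.4).

The tree's discharge `AbsTopIII.cor_1_10_i_holds` (`ReconstructionCor110iProofs.lean`) proves the
named fact `AbsTopIII.Cor_1_10_i M` for models `M : CurveModel.{0}` only, because its local class
field theory inputs ([AbsAnab] Prop. 1.2.1 (ii), (iv)) bind the local field `K : Type`.  This file
removes the universe restriction WITHOUT touching those inputs:

* `absGalCongr` / `absGalCongrₜ` — **absolute Galois groups of isomorphic fields are isomorphic as
  topological groups**, for fields `K₁ : Type u`, `K₂ : Type v` in ARBITRARY universes: an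
  isomorphism `e : K₁ ≃+* K₂` extends to the algebraic closures (Mathlib `IsAlgClosure.equivOfEquiv`),
  and conjugation by the extension is a group isomorphism `Gal(K̄₁/K₁) ⥲ Gal(K̄₂/K₂)` which is
  continuous for the Krull topologies (the preimage of `Gal(K̄₂/E)`, `E/K₂` finite, contains
  `Gal(K̄₁/φ⁻¹E)`).  (Universe-polymorphic re-run of abc-iut-L1-d4's `PadicKummer.galConjₜ`,
  `Frobenioids/PadicKummerLocalFieldIso.lean`, which is stated at `Type` only.)
* `IsMLF.small` / `IsMLF.shrink` — an MLF `K : Type u` (a finite extension of some `ℚ_p`) is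
  `Small.{0}`, and its copy `Shrink.{0} K : Type` is again an MLF.
* `exists_frobQuot_of_extension_univ`, `CurveModel.exists_localField_gal_of_isMLF_univ` — the two
  steps of the universe-`0` proof re-run at `FundamentalExtension.{u}` / `CurveModel.{u}`, the local
  field being taken in `Type` (`Shrink.{0} (M.base X)`), so that the LANDED universe-`0` theorem
  `exists_frobeniusQuotient_charZHat` applies verbatim.
* `AbsTopIII.cor_1_10_i_holds_univ (M : CurveModel.{u}) : AbsTopIII.Cor_1_10_i M` and the closed
  form `AbsTopIII.cor_1_10_i_forall`.

HONEST SCOPE: exactly as in `ReconstructionCor110iProofs.lean` — only the EXISTENCE of an algorithm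
with a surjective, characteristic Frobenius quotient is asserted by `Cor_1_10_i`; the other output
fields carry placeholder values (here over `ULift ℚ`); Cor. 1.10 (i)(a), (ii), (iii) are separate
named facts and are NOT addressed.  Proof-only file (no definitions of mathematical content beyond
the transport isomorphism; no named facts; FACT-LIST untouched); classical; nothing here bears on
[IUTchIII] Cor. 3.12 or takes a side.
-/

noncomputable section

open CategoryTheory Function
open ProfiniteGrp ProfiniteGrp.ProfiniteCompletion Topology

universe u v

namespace Literature.AnabelianGeometry.AbsoluteAnabelian

open Field ValuativeRel
open Literature.NumberTheory.GaloisRepresentations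
open Literature.NumberTheory.GaloisRepresentations.IsNonarchimedeanLocalField

/-! ### Transport of absolute Galois groups along a field isomorphism (any universes) -/

section GalTransport

variable {K₁ : Type u} {K₂ : Type v} [Field K₁] [Field K₂] (e : K₁ ≃+* K₂)

/-- An isomorphism `K̄₁ ≃+* K̄₂` of the (Mathlib) algebraic closures extending `e : K₁ ≃+* K₂`
(Mathlib `IsAlgClosure.equivOfEquiv`; a CHOSEN extension — any two differ by `Gal(K̄₂/K₂)`).
[folklore] -/
def algClosureCongr : AlgebraicClosure K₁ ≃+* AlgebraicClosure K₂ :=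
  IsAlgClosure.equivOfEquiv (AlgebraicClosure K₁) (AlgebraicClosure K₂) e

/-- `algClosureCongr e` extends `e` (folklore; recorded for the universe transport of
[AbsTopIII] Cor. 1.10 (i)). [cite: MochizukiAbsTopIII2015, Cor 1.10 (i) p.42] -/
@[simp] theorem algClosureCongr_algebraMap (x : K₁) :
    algClosureCongr e (algebraMap K₁ (AlgebraicClosure K₁) x) =
      algebraMap K₂ (AlgebraicClosure K₂) (e x) :=
  IsAlgClosure.equivOfEquiv_algebraMap _ _ e x

/-- `(algClosureCongr e)⁻¹` extends `e⁻¹` (folklore). [cite: MochizukiAbsTopIII2015, Cor 1.10 (i) p.42] -/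
@[simp] theorem algClosureCongr_symm_algebraMap (y : K₂) :
    (algClosureCongr e).symm (algebraMap K₂ (AlgebraicClosure K₂) y) =
      algebraMap K₁ (AlgebraicClosure K₁) (e.symm y) :=
  IsAlgClosure.equivOfEquiv_symm_algebraMap _ _ e y

/-- Conjugation by `φ = algClosureCongr e`: a `K₁`-automorphism `σ` of `K̄₁` yields the
`K₂`-automorphism `φ ∘ σ ∘ φ⁻¹` of `K̄₂`. [folklore] -/
def conjAlgEquiv (σ : AlgebraicClosure K₁ ≃ₐ[K₁] AlgebraicClosure K₁) :
    AlgebraicClosure K₂ ≃ₐ[K₂] AlgebraicClosure K₂ :=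
  AlgEquiv.ofRingEquiv
    (f := ((algClosureCongr e).symm.trans (σ : AlgebraicClosure K₁ ≃+* AlgebraicClosure K₁)).trans
      (algClosureCongr e)) (by
    intro y
    simp only [RingEquiv.trans_apply, algClosureCongr_symm_algebraMap, AlgEquiv.coe_ringEquiv,
      AlgEquiv.commutes, algClosureCongr_algebraMap, RingEquiv.apply_symm_apply])

/-- `conjAlgEquiv e σ y = φ (σ (φ⁻¹ y))` (folklore). [cite: MochizukiAbsTopIII2015, Cor 1.10 (i) p.42] -/
@[simp] theorem conjAlgEquiv_apply (σ : AlgebraicClosure K₁ ≃ₐ[K₁] AlgebraicClosure K₁)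
    (y : AlgebraicClosure K₂) :
    conjAlgEquiv e σ y = algClosureCongr e (σ ((algClosureCongr e).symm y)) := rfl

/-- Inverse conjugation: a `K₂`-automorphism `τ` of `K̄₂` yields the `K₁`-automorphism
`φ⁻¹ ∘ τ ∘ φ` of `K̄₁`. [folklore] -/
def conjAlgEquivInv (τ : AlgebraicClosure K₂ ≃ₐ[K₂] AlgebraicClosure K₂) :
    AlgebraicClosure K₁ ≃ₐ[K₁] AlgebraicClosure K₁ :=
  AlgEquiv.ofRingEquiv
    (f := ((algClosureCongr e).trans (τ : AlgebraicClosure K₂ ≃+* AlgebraicClosure K₂)).trans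
      (algClosureCongr e).symm) (by
    intro x
    simp only [RingEquiv.trans_apply, algClosureCongr_algebraMap, AlgEquiv.coe_ringEquiv,
      AlgEquiv.commutes, algClosureCongr_symm_algebraMap, RingEquiv.symm_apply_apply])

/-- `conjAlgEquivInv e τ x = φ⁻¹ (τ (φ x))` (folklore). [cite: MochizukiAbsTopIII2015, Cor 1.10 (i) p.42] -/
@[simp] theorem conjAlgEquivInv_apply (τ : AlgebraicClosure K₂ ≃ₐ[K₂] AlgebraicClosure K₂)
    (x : AlgebraicClosure K₁) :
    conjAlgEquivInv e τ x = (algClosureCongr e).symm (τ (algClosureCongr e x)) := rfl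

/-- Conjugation by `φ` as a group isomorphism `Gal(K̄₁/K₁) ⥲ Gal(K̄₂/K₂)` of automorphism groups.
[folklore] -/
def conjMulEquiv :
    (AlgebraicClosure K₁ ≃ₐ[K₁] AlgebraicClosure K₁) ≃* (AlgebraicClosure K₂ ≃ₐ[K₂] AlgebraicClosure K₂) where
  toFun := conjAlgEquiv e
  invFun := conjAlgEquivInv e
  left_inv σ := by
    ext x
    simp only [conjAlgEquivInv_apply, conjAlgEquiv_apply, RingEquiv.symm_apply_apply]
  right_inv τ := by
    ext y
    simp only [conjAlgEquiv_apply, conjAlgEquivInv_apply, RingEquiv.apply_symm_apply]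
  map_mul' σ τ := by
    ext y
    simp only [conjAlgEquiv_apply, AlgEquiv.mul_apply, RingEquiv.symm_apply_apply]

/-- **`Gal(K̄₁/K₁) ⥲ Gal(K̄₂/K₂)` along `e : K₁ ≃+* K₂`** (abstract groups; Mathlib's
`Field.absoluteGaloisGroup`), `σ ↦ φ σ φ⁻¹` for a chosen extension `φ` of `e` to the algebraic
closures. [folklore] -/
def absGalCongr : absoluteGaloisGroup K₁ ≃* absoluteGaloisGroup K₂ :=
  ((absoluteGaloisGroup.toAlgEquiv K₁).trans (conjMulEquiv e)).trans
    (absoluteGaloisGroup.toAlgEquiv K₂).symm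

/-- `absGalCongr e σ` acts on `K̄₂` by `y ↦ φ (σ • φ⁻¹ y)` (folklore). [cite: MochizukiAbsTopIII2015, Cor 1.10 (i) p.42] -/
@[simp] theorem absGalCongr_smul (σ : absoluteGaloisGroup K₁) (y : AlgebraicClosure K₂) :
    absGalCongr e σ • y = algClosureCongr e (σ • (algClosureCongr e).symm y) := rfl

/-- `φ⁻¹ E`, for an intermediate field `E` of `K̄₂/K₂`, as an intermediate field of `K̄₁/K₁`.
[folklore] -/
def comapIntermediateField (E : IntermediateField K₂ (AlgebraicClosure K₂)) :
    IntermediateField K₁ (AlgebraicClosure K₁) :=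
  (E.toSubfield.comap (algClosureCongr e).toRingHom).toIntermediateField fun x => by
    change algClosureCongr e (algebraMap K₁ (AlgebraicClosure K₁) x) ∈ E
    rw [algClosureCongr_algebraMap]
    exact E.algebraMap_mem (e x)

/-- Membership in `φ⁻¹ E` (folklore). [cite: MochizukiAbsTopIII2015, Cor 1.10 (i) p.42] -/
theorem mem_comapIntermediateField_iff (E : IntermediateField K₂ (AlgebraicClosure K₂))
    (x : AlgebraicClosure K₁) : x ∈ comapIntermediateField e E ↔ algClosureCongr e x ∈ E :=
  Iff.rfl

/-- `E ⥲ φ⁻¹ E` as rings (restriction of `φ⁻¹`). [folklore] -/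
def comapRingEquiv (E : IntermediateField K₂ (AlgebraicClosure K₂)) :
    E ≃+* comapIntermediateField e E where
  toFun y := ⟨(algClosureCongr e).symm y, by
    rw [mem_comapIntermediateField_iff, RingEquiv.apply_symm_apply]; exact y.2⟩
  invFun x := ⟨algClosureCongr e x, x.2⟩
  left_inv y := Subtype.ext ((algClosureCongr e).apply_symm_apply _)
  right_inv x := Subtype.ext ((algClosureCongr e).symm_apply_apply _)
  map_mul' a b := Subtype.ext (map_mul (algClosureCongr e).symm _ _)
  map_add' a b := Subtype.ext (map_add (algClosureCongr e).symm _ _)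

/-- `φ⁻¹ E` is finite over `K₁` when `E` is finite over `K₂` (transport along the `e`-semilinear
`E ⥲ φ⁻¹ E`; folklore). [cite: MochizukiAbsTopIII2015, Cor 1.10 (i) p.42] -/
theorem finiteDimensional_comap (E : IntermediateField K₂ (AlgebraicClosure K₂))
    [FiniteDimensional K₂ E] : FiniteDimensional K₁ (comapIntermediateField e E) := by
  refine Module.Finite.of_equiv_equiv e.symm (comapRingEquiv e E) (RingHom.ext fun y => ?_)
  apply Subtype.ext
  change algebraMap K₁ (AlgebraicClosure K₁) (e.symm y) =
    (algClosureCongr e).symm (algebraMap K₂ (AlgebraicClosure K₂) y)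
  rw [algClosureCongr_symm_algebraMap]

/-- **Continuity of `Gal(K̄₁/K₁) ⥲ Gal(K̄₂/K₂)` for the Krull topologies**: the preimage of
`Gal(K̄₂/E)` (`E/K₂` finite) contains `Gal(K̄₁/φ⁻¹E)` (folklore: functoriality of `G_K` in the
field). [cite: MochizukiAbsTopIII2015, Cor 1.10 (i) p.42] -/
theorem continuous_absGalCongr : Continuous (absGalCongr e) := by
  apply continuous_of_continuousAt_one _ (continuousAt_def.mpr _)
  intro N hN
  rw [map_one] at hN
  obtain ⟨E, hEfd, hE⟩ := (krullTopology_mem_nhds_one_iff K₂ (AlgebraicClosure K₂) N).mp hN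
  haveI := hEfd
  haveI := finiteDimensional_comap e E
  refine (krullTopology_mem_nhds_one_iff K₁ (AlgebraicClosure K₁) _).mpr
    ⟨comapIntermediateField e E, inferInstance, fun σ hσ => hE ?_⟩
  rw [SetLike.mem_coe, IntermediateField.mem_fixingSubgroup_iff] at hσ
  rw [SetLike.mem_coe, IntermediateField.mem_fixingSubgroup_iff]
  intro y hy
  have h1 := hσ ((algClosureCongr e).symm y)
    ((mem_comapIntermediateField_iff e E _).mpr (by rw [RingEquiv.apply_symm_apply]; exact hy))
  change algClosureCongr e (σ ((algClosureCongr e).symm y)) = y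
  rw [h1, RingEquiv.apply_symm_apply]

/-- The inverse of `absGalCongr e` acts on `K̄₁` by `x ↦ φ⁻¹ (τ • φ x)` (folklore). [cite: MochizukiAbsTopIII2015, Cor 1.10 (i) p.42] -/
@[simp] theorem absGalCongr_symm_smul (τ : absoluteGaloisGroup K₂) (x : AlgebraicClosure K₁) :
    (absGalCongr e).symm τ • x = (algClosureCongr e).symm (τ • algClosureCongr e x) := rfl

/-- Continuity of the inverse `Gal(K̄₂/K₂) ⥲ Gal(K̄₁/K₁)`: the preimage of `Gal(K̄₁/E')` (`E'/K₁`
finite) contains `Gal(K̄₂/φE')` (folklore). [cite: MochizukiAbsTopIII2015, Cor 1.10 (i) p.42] -/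
theorem continuous_absGalCongr_symm : Continuous (absGalCongr e).symm := by
  apply continuous_of_continuousAt_one _ (continuousAt_def.mpr _)
  intro N hN
  rw [map_one] at hN
  obtain ⟨E, hEfd, hE⟩ := (krullTopology_mem_nhds_one_iff K₁ (AlgebraicClosure K₁) N).mp hN
  haveI := hEfd
  -- `φ E'` as an intermediate field of `K̄₂/K₂`, finite over `K₂`
  let E' : IntermediateField K₂ (AlgebraicClosure K₂) :=
    (E.toSubfield.comap (algClosureCongr e).symm.toRingHom).toIntermediateField fun y => by
      change (algClosureCongr e).symm (algebraMap K₂ (AlgebraicClosure K₂) y) ∈ E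
      rw [algClosureCongr_symm_algebraMap]
      exact E.algebraMap_mem (e.symm y)
  have hmem : ∀ y : AlgebraicClosure K₂, y ∈ E' ↔ (algClosureCongr e).symm y ∈ E := fun _ => Iff.rfl
  let ε : E ≃+* E' :=
    { toFun := fun x => ⟨algClosureCongr e x, by
        rw [hmem, RingEquiv.symm_apply_apply]; exact x.2⟩
      invFun := fun y => ⟨(algClosureCongr e).symm y, y.2⟩
      left_inv := fun x => Subtype.ext ((algClosureCongr e).symm_apply_apply _)
      right_inv := fun y => Subtype.ext ((algClosureCongr e).apply_symm_apply _)
      map_mul' := fun a b => Subtype.ext (map_mul (algClosureCongr e) _ _)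
      map_add' := fun a b => Subtype.ext (map_add (algClosureCongr e) _ _) }
  haveI : FiniteDimensional K₂ E' := by
    refine Module.Finite.of_equiv_equiv e ε (RingHom.ext fun x => ?_)
    apply Subtype.ext
    change algebraMap K₂ (AlgebraicClosure K₂) (e x) =
      algClosureCongr e (algebraMap K₁ (AlgebraicClosure K₁) x)
    rw [algClosureCongr_algebraMap]
  refine (krullTopology_mem_nhds_one_iff K₂ (AlgebraicClosure K₂) _).mpr
    ⟨E', inferInstance, fun τ hτ => hE ?_⟩
  rw [SetLike.mem_coe, IntermediateField.mem_fixingSubgroup_iff] at hτ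
  rw [SetLike.mem_coe, IntermediateField.mem_fixingSubgroup_iff]
  intro x hx
  have h1 := hτ (algClosureCongr e x) ((hmem _).mpr (by rw [RingEquiv.symm_apply_apply]; exact hx))
  change (algClosureCongr e).symm (τ (algClosureCongr e x)) = x
  rw [h1, RingEquiv.symm_apply_apply]

/-- **Absolute Galois groups of isomorphic fields are isomorphic as TOPOLOGICAL groups**, across
universes: `Gal(K̄₁/K₁) ≃ₜ* Gal(K̄₂/K₂)` along `e : K₁ ≃+* K₂` (`K₁ : Type u`, `K₂ : Type v`).
[folklore] -/
def absGalCongrₜ : absoluteGaloisGroup K₁ ≃ₜ* absoluteGaloisGroup K₂ :=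
  { absGalCongr e with
    continuous_toFun := continuous_absGalCongr e
    continuous_invFun := continuous_absGalCongr_symm e }

/-- `absGalCongrₜ` is `absGalCongr` on elements (folklore). [cite: MochizukiAbsTopIII2015, Cor 1.10 (i) p.42] -/
@[simp] theorem absGalCongrₜ_apply (σ : absoluteGaloisGroup K₁) :
    absGalCongrₜ e σ = absGalCongr e σ := rfl

end GalTransport

/-! ### An MLF is small, and its small copy is an MLF -/

/-- A mixed-characteristic local field `K : Type u` ("a finite field extension of `ℚ_p`", [AbsTopI]
§0 p. 7) is `Small.{0}`: it is the image of some `ℚ_p^n`. [cite: MochizukiAbsTopI2012, §0 p.7] -/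
theorem IsMLF.small {K : Type u} [Field K] (h : IsMLF K) : Small.{0} K := by
  obtain ⟨p, hp, f, hfin⟩ := h.exists_padic
  letI : Algebra ℚ_[p] K := f.toAlgebra
  haveI : Module.Finite ℚ_[p] K := hfin
  obtain ⟨n, g, hg⟩ := Module.Finite.exists_fin' ℚ_[p] K
  exact small_of_surjective hg

/-- The small copy `Shrink K` of an MLF `K` ("a finite field extension of `ℚ_p`", [AbsTopI] §0
p. 7) is an MLF (transport of the finite `ℚ_p`-algebra structure along `Shrink.ringEquiv`).
[cite: MochizukiAbsTopI2012, §0 p.7] -/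
theorem IsMLF.shrink {K : Type u} [Field K] (h : IsMLF K) [Small.{v} K] : IsMLF (Shrink.{v} K) := by
  obtain ⟨p, hp, f, hfin⟩ := h.exists_padic
  let g : K ≃+* Shrink.{v} K := (Shrink.ringEquiv K).symm
  refine ⟨p, hp, g.toRingHom.comp f, ?_⟩
  letI : Algebra ℚ_[p] K := f.toAlgebra
  letI : Algebra ℚ_[p] (Shrink.{v} K) := (g.toRingHom.comp f).toAlgebra
  haveI : Module.Finite ℚ_[p] K := hfin
  exact Module.Finite.of_equiv_equiv (RingEquiv.refl ℚ_[p]) g (RingHom.ext fun x => rfl)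

/-! ### The witness character on an abstract extension, any universe -/

/-- For an abstract extension `E : FundamentalExtension.{u}`, a continuous character `E.gal → Ẑ`
which — WHENEVER `E.gal` is isomorphic, as a topological group, to the absolute Galois group of
some characteristic-`0` non-archimedean local field `F : Type` — is surjective and invariant under
every automorphism of the profinite group `E.gal`: transport of the universe-`0` theorem
`exists_frobeniusQuotient_charZHat` along a CHOSEN identification; the trivial character when no
such identification exists. [cite: MochizukiAbsTopIII2015, Cor 1.10 (i) p.42] -/
theorem exists_frobQuot_of_extension_univ (E : FundamentalExtension.{u}) :
    ∃ fE : E.gal →ₜ* completion (GrpCat.of (Multiplicative ℤ)),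
      (∃ (F : Type) (_ : Field F) (_ : ValuativeRel F) (_ : TopologicalSpace F)
          (_ : IsNonarchimedeanLocalField F) (_ : CharZero F),
          Nonempty (E.gal ≃ₜ* absoluteGaloisGroup F)) →
        Surjective fE ∧ ∀ (ψ : E.gal ≃ₜ* E.gal) (g : E.gal), fE (ψ g) = fE g := by
  classical
  by_cases h : ∃ (F : Type) (_ : Field F) (_ : ValuativeRel F) (_ : TopologicalSpace F)
      (_ : IsNonarchimedeanLocalField F) (_ : CharZero F), Nonempty (E.gal ≃ₜ* absoluteGaloisGroup F)
  · obtain ⟨F, _, _, _, _, _, ⟨e⟩⟩ := h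
    obtain ⟨f, hsurj, -, -, hinv⟩ := exists_frobeniusQuotient_charZHat F
    refine ⟨f.comp (e : E.gal →ₜ* absoluteGaloisGroup F), fun _ => ⟨hsurj.comp e.surjective, ?_⟩⟩
    intro ψ g
    have key := hinv (e.symm.trans (ψ.trans e)) (e g)
    change f (e (ψ (e.symm (e g)))) = f (e g) at key
    rw [e.symm_apply_apply] at key
    exact key
  · exact ⟨{ (1 : E.gal →* completion (GrpCat.of (Multiplicative ℤ))) with
        continuous_toFun := continuous_const }, fun h' => (h h').elim⟩

namespace AbsTopIII

/-! ### Curves of a model over an MLF, any universe: the Galois group is that of a `Type`-local field -/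

/-- For a curve `X` of a model `M : CurveModel.{u}` whose base field `k : Type u` is an MLF,
`G = (M.ext X).gal` is isomorphic as a topological group to the absolute Galois group of a
characteristic-`0` non-archimedean local field IN `Type` — namely the small copy
`F = Shrink.{0} k` of `k` with the valued structure of a finite extension of `ℚ_p`, through the
model identification `M.galIso X : G ≅ Gal(k̄/k)` and the transport `Gal(k̄/k) ≃ₜ* Gal(F̄/F)`
along `k ≃+* F` (`absGalCongrₜ`). [cite: MochizukiAbsTopIII2015, Cor 1.10 p.41] -/
theorem CurveModel.exists_localField_gal_of_isMLF_univ (M : CurveModel.{u}) (X : M.Curve)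
    (hX : IsMLF (M.base X)) :
    ∃ (F : Type) (_ : Field F) (_ : ValuativeRel F) (_ : TopologicalSpace F)
      (_ : IsNonarchimedeanLocalField F) (_ : CharZero F),
      Nonempty ((M.ext X).gal ≃ₜ* absoluteGaloisGroup F) := by
  haveI : Small.{0} (M.base X) := hX.small
  have hF : IsMLF (Shrink.{0} (M.base X)) := hX.shrink
  obtain ⟨p, hp, φ, hfin⟩ := hF.exists_padic
  letI : Algebra ℚ_[p] (Shrink.{0} (M.base X)) := φ.toAlgebra
  haveI : Module.Finite ℚ_[p] (Shrink.{0} (M.base X)) := hfin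
  haveI : IsNonarchimedeanLocalField ℚ_[p] := Padic.isNonarchimedeanLocalField_holds p
  letI := FiniteExtension.normedField ℚ_[p] (Shrink.{0} (M.base X))
  letI := FiniteExtension.valuativeRel ℚ_[p] (Shrink.{0} (M.base X))
  haveI : IsNonarchimedeanLocalField (Shrink.{0} (M.base X)) :=
    FiniteExtension.isNonarchimedeanLocalField ℚ_[p] (Shrink.{0} (M.base X))
  haveI : CharZero (Shrink.{0} (M.base X)) :=
    charZero_of_injective_algebraMap (algebraMap ℚ_[p] (Shrink.{0} (M.base X))).injective
  obtain ⟨e₀⟩ := nonempty_continuousMulEquiv_of_iso (M.galIso X)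
  exact ⟨Shrink.{0} (M.base X), inferInstance, inferInstance, inferInstance, inferInstance,
    inferInstance, ⟨e₀.trans (absGalCongrₜ (Shrink.ringEquiv (M.base X)).symm)⟩⟩

/-! ### Cor. 1.10 (i)(b): the named fact at every universe -/

/-- **[AbsTopIII] Cor. 1.10 (i)(b) — the named fact `Cor_1_10_i M` HOLDS for every model
`M : CurveModel.{u}`, at every universe `u`**: there is an `MLFReconstructionAlgorithm` whose
Frobenius quotient `frobQuot : G → Ẑ` is, on every curve of `M` over an MLF `k`, SURJECTIVE
("`G_k^ab ↠ G^unr ⥲ Ẑ`") and INVARIANT under every automorphism of the profinite group `G = G_k`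
(Rmk. 1.9.4: "may be characterized by an entirely group-theoretic algorithm").  Witness as in the
universe-`0` discharge `cor_1_10_i_holds`: `frobQuot E` = the Frobenius quotient character of a
`Type`-local field transported along a chosen identification of `E.gal`
(`exists_frobQuot_of_extension_univ`); the other output fields (cyclotomes, Kummer container, `k`,
`K_X`, decomposition groups — items (a), (c), (d), (ii), (iii), NOT asserted by this fact) are
placeholders over `ULift ℚ`. [cite: MochizukiAbsTopIII2015, Cor 1.10 (i) p.42] -/
theorem cor_1_10_i_holds_univ (M : CurveModel.{u}) :
    Literature.AnabelianGeometry.AbsoluteAnabelian.AbsTopIII.Cor_1_10_i M := by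
  classical
  choose fE hfE using exists_frobQuot_of_extension_univ.{u}
  refine ⟨{ obj := fun E =>
              { galCyclotome := PUnit
                arithCyclotome := PUnit
                cycloSync := AddEquiv.refl PUnit
                frobQuot := fE E
                H1 := (ULift.{u} ℚ)ˣ
                baseField := ULift.{u} ℚ
                kummerBase := MonoidHom.id (ULift.{u} ℚ)ˣ
                kummerBase_injective := fun _ _ h => h
                functionField := ULift.{u} ℚ
                closedPointDecomp := ∅ }
            map := fun _ => ⟨RingEquiv.refl _, RingEquiv.refl _, fun _ => rfl⟩
            map_id := fun _ => rfl
            map_comp := fun _ _ => rfl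
            comap := fun _ _ => RingHom.id (ULift.{u} ℚ)
            comap_map := fun _ _ _ => rfl }, ?_⟩
  intro X hX
  exact hfE (M.ext X) (CurveModel.exists_localField_gal_of_isMLF_univ M X hX)

/-- **[AbsTopIII] Cor. 1.10 (i)(b), closed universe-polymorphic form**: the named fact
`Cor_1_10_i` (FACT-LIST F-0394) holds for ALL models at universe `u`.
[cite: MochizukiAbsTopIII2015, Cor 1.10 (i) p.42] -/
theorem cor_1_10_i_forall :
    ∀ M : CurveModel.{u}, Literature.AnabelianGeometry.AbsoluteAnabelian.AbsTopIII.Cor_1_10_i M :=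
  cor_1_10_i_holds_univ

end AbsTopIII

end Literature.AnabelianGeometry.AbsoluteAnabelian

end
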